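import Summits.ResolutionOfSingularities.ResolutionOfSingularities.Theorems.HilbertSamuelEliminationSigmaMaxModificationsCorridor3SigmaSurfaceBadnessPointCure
import Literature.AlgebraicGeometry.Resolution.BlowupExceptionalGenericOrder
import Literature.AlgebraicGeometry.Resolution.BlowupExceptionalFibreIrreducible
import Literature.AlgebraicGeometry.Resolution.BlowupsIntegral
import Literature.AlgebraicGeometry.Resolution.GenericPointStalkData
import HarnessLib

/-!
# [OURS · L1 W4.2] σ-LAYER PHASE B′ — `Corridor3SigmaSurfaceBadnessPointCureExc`: THE EXCEPTIONAL DIVISOR OF THE CURE-POINT STEP — `E = ρ⁻¹(x)` is irreducible, its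
# generic point `η_E` is the ONLY point of codimension one over `x`, the new member `ρ^*𝓘_x` has order `1` along it, a member through `x` of order `m` at `x` has
# order `m − 1` along it, and when exactly one member passes through `x`, with order `2` (a counted same-member crossing), the multiplicity list of `E` is `[1, 1]`
# (`μ_E = 1`: DESIGN CHECK 2 (b) «`M_E = +1`»)
# (crux chain w42 `SigmaMaxModifications` stmt-ResolutionOfSingularities-18506 / conjunct `SigmaMaxModificationsCorridor3` stmt-ResolutionOfSingularities-19249; helper of
# res-L1-w42-stub-1 (gen 6), `--supports stmt-…-19249 --as helper`, counted 0)

HONEST FRAMING. OURS bookkeeping over Literature `IsBlowup.isIrreducible_preimage_singleton` (Hartshorne II 8.24 (b)), `IsBlowup.idealOrder_controlledTransform_of_mem_maxPoints`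
/ `IsBlowup.exists_uniformizer_of_mem_maxPoints` (the exceptional valuation is the order at the centre, Stacks 0804 / 0BIQ), `IsBlowup.isIntegral`, Mathlib's sober-space
generic points, and this seat's `…SurfaceBadnessPointCure`. NOTHING here is a statement of H. Hironaka's manuscript [Hironaka2017] nor of [CossartJannsenSaito2020]; no
named fact. AI-written; AI review is weaker than expert review.

## Contents (namespace `…Theorems.SigmaMaxModificationsCorridor3.Sigma`)

* `coe_support_pointIdeal`, `stalkIdeal_pointIdeal_self`, `pointIdeal_ne_bot`, `maximalIdeal_ne_bot_of_coheight_eq_two`; `isIrreducible_excFibre`, **`excPoint`** (its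
  generic point `η_E`), `base_excPoint`, `specializes_excPoint_iff`, `excPoint_mem_maxPoints`, **`eq_excPoint_of_coheight_eq_one`** (the only codimension-one point over
  `x`).
* Orders along `E`: `idealOrder_eq_of_stalkIdeal_eq_pow_of_not_isField`, **`idealOrder_comap_pointIdeal_excPoint`** (`= 1`), **`idealOrder_pointCureMember_excPoint`**
  (`= ord_x Γ − 1` for a member through `x`), `mem_support_pointCureMember_excPoint_iff`, `not_mem_support_pointCureMember_excPoint`,
  **`Boundary.compMults_pointCure_excPoint`** (`= [1, 1]` when exactly one member passes through `x`, with order `2`), `coheight_excPoint` (`= 1`: Krull, principal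
  `𝔪_{η_E}`), `excPoint_mem_codimOnePoints_pointCure`.

VACUITY SELF-CHECK. Hypotheses: `D` regular integral Noetherian, `x` a closed point of codimension two (`coheight x = 2`, so `𝔪_x ≠ 0` and `𝓘_x ≠ 0`), `ρ` a blow-up
of `𝓘_x` — the cure-point step of (P1*) on a surface.
-/

noncomputable section

set_option linter.dupNamespace false -- mandated namespace of this single-conjunct summit

open CategoryTheory AlgebraicGeometry TopologicalSpace IsLocalRing
open Summit.ResolutionOfSingularities.ResolutionOfSingularities.Theorems.CampaignW42
open Literature.AlgebraicGeometry.Resolution Literature.RingTheory.HilbertSamuel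

namespace Summit.ResolutionOfSingularities.ResolutionOfSingularities.Theorems.SigmaMaxModificationsCorridor3.Sigma

universe u

open Scheme.IdealSheafData

/-! ## The point ideal -/

section PointIdeal

variable {D : Scheme.{u}} {x : D} (hxc : IsClosed ({x} : Set D))

/-- The support of `𝓘_x` is `{x}`. [folklore] -/
theorem coe_support_pointIdeal : ((vanishingIdeal ⟨{x}, hxc⟩).support : Set D) = {x} :=
  Scheme.IdealSheafData.coe_support_vanishingIdeal _

/-- `(𝓘_x)_x = 𝔪_x`. [folklore] -/
theorem stalkIdeal_pointIdeal_self : stalkIdeal (vanishingIdeal ⟨{x}, hxc⟩) x = maximalIdeal (D.presheaf.stalk x) := by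
  have : (⟨{x}, hxc⟩ : Closeds D) = ⟨closure {x}, isClosed_closure⟩ := Closeds.ext hxc.closure_eq.symm
  rw [this]
  exact stalkIdeal_vanishingIdeal_closure_self x

/-- A point of codimension two is not the generic point, so `𝓘_x ≠ 0`. [folklore] -/
theorem pointIdeal_ne_bot [IrreducibleSpace D] (hx2 : Order.coheight x = 2) : vanishingIdeal ⟨{x}, hxc⟩ ≠ ⊥ := by
  intro h
  have hgen : genericPoint D ∈ ((vanishingIdeal ⟨{x}, hxc⟩).support : Set D) := by rw [h, Scheme.IdealSheafData.support_bot]; trivial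
  rw [coe_support_pointIdeal, Set.mem_singleton_iff] at hgen
  have h0 : Order.coheight (genericPoint D) = 0 := by
    rw [Order.coheight_eq_zero]
    intro y hy
    exact Scheme.le_iff_specializes.mpr (genericPoint_specializes y)
  rw [hgen, hx2] at h0
  exact two_ne_zero h0

/-- A point of codimension two has `𝔪_x ≠ 0`. [folklore] -/
theorem maximalIdeal_ne_bot_of_coheight_eq_two (hx2 : Order.coheight x = 2) : maximalIdeal (D.presheaf.stalk x) ≠ ⊥ := by
  intro h
  have hf : IsField (D.presheaf.stalk x) := isField_iff_maximalIdeal_eq.mpr h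
  have h0 : ringKrullDim (D.presheaf.stalk x) = 0 := by
    rw [← IsLocalRing.maximalIdeal_height_eq_ringKrullDim, h, Ideal.height_bot]; rfl
  rw [ringKrullDim_stalk_eq_coheight, hx2] at h0
  exact absurd h0 (by decide)

end PointIdeal

/-! ## The exceptional divisor and its generic point -/

section Exceptional

variable {D D' : Scheme.{u}} {x : D} {hxc : IsClosed ({x} : Set D)} {ρ : D' ⟶ D} (hρ : IsBlowup ρ (vanishingIdeal ⟨{x}, hxc⟩)) (hreg : Scheme.IsRegular D)
  (hx2 : Order.coheight x = 2)

include hρ hreg hx2 in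
/-- **The exceptional divisor `E = ρ⁻¹(x)` is irreducible** (a `ℙ¹` over `κ(x)`; Literature `IsBlowup.isIrreducible_preimage_singleton`). [cite: Hartshorne1977, II Thm. 8.24 (b)] -/
theorem isIrreducible_excFibre : IsIrreducible (ρ.base ⁻¹' {x}) := by
  haveI := hreg x
  exact hρ.isIrreducible_preimage_singleton x (stalkIdeal_pointIdeal_self hxc) (maximalIdeal_ne_bot_of_coheight_eq_two hx2)

/-- [OURS · L1 W4.2] **THE GENERIC POINT `η_E` OF THE EXCEPTIONAL DIVISOR** of the cure-point step. NOT a statement of the manuscript. [folklore] -/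
def excPoint : D' :=
  (isIrreducible_excFibre hρ hreg hx2).genericPoint

include hρ hreg hx2 in
/-- `η_E` is a generic point of `E` (which is closed). [folklore] -/
theorem isGenericPoint_excPoint : IsGenericPoint (excPoint hρ hreg hx2) (ρ.base ⁻¹' {x}) :=
  (isIrreducible_excFibre hρ hreg hx2).isGenericPoint_genericPoint (hxc.preimage ρ.continuous)

/-- `η_E` lies over `x`. [folklore] -/
theorem base_excPoint : ρ.base (excPoint hρ hreg hx2) = x :=
  (isGenericPoint_excPoint hρ hreg hx2).mem

/-- **`η_E ⤳ y′ ↔ y′ ∈ E`.** [folklore] -/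
theorem specializes_excPoint_iff {y' : D'} : excPoint hρ hreg hx2 ⤳ y' ↔ ρ.base y' = x :=
  (isGenericPoint_excPoint hρ hreg hx2).specializes_iff_mem

/-- `η_E` is a maximal point of `E = ρ⁻¹ V(𝓘_x)`. [folklore] -/
theorem excPoint_mem_maxPoints : excPoint hρ hreg hx2 ∈ maxPoints (ρ.base ⁻¹' ((⟨{x}, hxc⟩ : Closeds D) : Set D)) := by
  refine ⟨base_excPoint hρ hreg hx2, fun η' hη' hs => ?_⟩
  have h1 : excPoint hρ hreg hx2 ⤳ η' := (specializes_excPoint_iff hρ hreg hx2).mpr hη'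
  exact (hs.antisymm h1).eq

include hρ hreg hx2 in
/-- **`η_E` IS THE ONLY POINT OF CODIMENSION ONE OVER `x`** (integral `D′`, some point of `D` other than `x`): a second one would be a proper specialisation of `η_E`,
forcing `coheight η_E = 0`, i.e. `E = D′`, i.e. `ρ(D′) = {x}`. [folklore] -/
theorem eq_excPoint_of_coheight_eq_one [IsIntegral D'] {ζ' : D'} (hζ' : ρ.base ζ' = x) (h1 : Order.coheight ζ' = 1) {y : D} (hy : y ≠ x) :
    ζ' = excPoint hρ hreg hx2 := by
  by_contra hne
  have hs : excPoint hρ hreg hx2 ⤳ ζ' := (specializes_excPoint_iff hρ hreg hx2).mpr hζ'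
  have hlt : ζ' < excPoint hρ hreg hx2 := lt_of_le_not_ge (Scheme.le_iff_specializes.mpr hs) fun h' =>
    hne ((Scheme.le_iff_specializes.mp h').antisymm hs).eq
  have h2 := Order.coheight_add_one_le hlt
  rw [h1] at h2
  have h0 : Order.coheight (excPoint hρ hreg hx2) = 0 := by
    rcases ENat.ne_top_iff_exists.mp (show Order.coheight (excPoint hρ hreg hx2) ≠ ⊤ from fun e => by simp [e] at h2) with ⟨c, hc⟩
    rw [← hc] at h2 ⊢
    have : c + 1 ≤ 1 := by exact_mod_cast h2
    have hc0 : c = 0 := by omega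
    simp [hc0]
  have hgen : excPoint hρ hreg hx2 = genericPoint D' := eq_genericPoint_of_coheight_eq_zero h0
  -- then every point of `D′` lies over `x`
  obtain ⟨y', hy'⟩ := exists_base_eq_of_ne hρ (coe_support_pointIdeal hxc) hy
  have : ρ.base y' = x := (specializes_excPoint_iff hρ hreg hx2).mp (hgen ▸ genericPoint_specializes y')
  exact hy (hy'.symm.trans this)

end Exceptional

/-! ## Orders along the exceptional divisor -/

section Orders

variable {D D' : Scheme.{u}} {x : D} {hxc : IsClosed ({x} : Set D)} {ρ : D' ⟶ D}
  (hρ : IsBlowup ρ (vanishingIdeal ⟨{x}, hxc⟩)) (hreg : Scheme.IsRegular D) (hx2 : Order.coheight x = 2)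

/-- `I_y = 𝔪_y^a ⇒ ord_y I = a` in a Noetherian local domain which is not a field. [folklore] -/
theorem idealOrder_eq_of_stalkIdeal_eq_pow_of_not_isField {I : D'.IdealSheafData} {y : D'} [IsNoetherianRing (D'.presheaf.stalk y)] [IsDomain (D'.presheaf.stalk y)]
    (hnf : ¬ IsField (D'.presheaf.stalk y)) {a : ℕ} (h : stalkIdeal I y = maximalIdeal (D'.presheaf.stalk y) ^ a) : idealOrder I y = a := by
  refine le_antisymm ?_ ((le_idealOrder_iff I y a).mpr h.le)
  by_contra hlt
  have h1 : ((a + 1 : ℕ) : ℕ∞) ≤ idealOrder I y := by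
    rw [Nat.cast_succ]
    exact Order.add_one_le_of_lt (not_le.mp hlt)
  rw [le_idealOrder_iff, h] at h1
  exact maximalIdeal_pow_succ_ne hnf a (le_antisymm (Ideal.pow_le_pow_right (Nat.le_succ a)) h1)

include hreg hx2 in
/-- **The new member has order one along `E`**: `ord_{η_E} (ρ^*𝓘_x) = 1` (`𝔪_{η_E} = (t) = (ρ^*𝓘_x)_{η_E}`). [cite: StacksProject, Tag 0804] -/
theorem idealOrder_comap_pointIdeal_excPoint [IsLocallyNoetherian D'] [IsIntegral D'] :
    idealOrder ((vanishingIdeal ⟨{x}, hxc⟩).comap ρ) (excPoint hρ hreg hx2) = 1 := by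
  haveI : IsRegularLocalRing (D.presheaf.stalk (ρ.base (excPoint hρ hreg hx2))) := hreg _
  have hy : stalkIdeal (vanishingIdeal ⟨{x}, hxc⟩) (ρ.base (excPoint hρ hreg hx2)) = maximalIdeal _ := by
    rw [base_excPoint hρ hreg hx2]; exact stalkIdeal_pointIdeal_self hxc
  obtain ⟨t, htnzd, hmax, hexc, -, -⟩ := hρ.exists_uniformizer_of_mem_maxPoints (excPoint_mem_maxPoints hρ hreg hx2) hy
  have hnf : ¬ IsField (D'.presheaf.stalk (excPoint hρ hreg hx2)) := by
    intro hf
    have h0 := isField_iff_maximalIdeal_eq.mp hf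
    rw [hmax, Ideal.span_singleton_eq_bot] at h0
    exact (nonZeroDivisors.ne_zero htnzd) h0
  exact idealOrder_eq_of_stalkIdeal_eq_pow_of_not_isField hnf (by rw [hexc, hmax, pow_one])

include hreg hx2 in
/-- **A member through `x` of order `m` at `x` has order `m − 1` along `E` after the cure-point step** (`ord_{η_E} ρᶜ(Γ,1) = ord_x Γ − 1`).
[cite: StacksProject, Tag 0804] -/
theorem idealOrder_pointCureMember_excPoint [IsLocallyNoetherian D'] {Γ : D.IdealSheafData} (hxΓ : x ∈ (Γ.support : Set D)) :
    idealOrder (pointCureMember x ρ (vanishingIdeal ⟨{x}, hxc⟩) Γ) (excPoint hρ hreg hx2) = idealOrder Γ x - 1 := by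
  haveI : IsRegularLocalRing (D.presheaf.stalk (ρ.base (excPoint hρ hreg hx2))) := hreg _
  have hy : stalkIdeal (vanishingIdeal ⟨{x}, hxc⟩) (ρ.base (excPoint hρ hreg hx2)) = maximalIdeal _ := by
    rw [base_excPoint hρ hreg hx2]; exact stalkIdeal_pointIdeal_self hxc
  rw [pointCureMember_of_mem hxΓ, hρ.idealOrder_controlledTransform_of_mem_maxPoints (excPoint_mem_maxPoints hρ hreg hx2) hy Γ 1, base_excPoint hρ hreg hx2,
    Nat.cast_one]

include hreg hx2 in
/-- **A member through `x` keeps `η_E` on it iff its order at `x` is `≥ 2`.** [folklore] -/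
theorem mem_support_pointCureMember_excPoint_iff [IsIntegral D] [IsLocallyNoetherian D] [IsLocallyNoetherian D'] {Γ : D.IdealSheafData} (hΓ0 : Γ ≠ ⊥) (hxΓ : x ∈ (Γ.support : Set D)) :
    excPoint hρ hreg hx2 ∈ ((pointCureMember x ρ (vanishingIdeal ⟨{x}, hxc⟩) Γ).support : Set D') ↔ 2 ≤ (idealOrder Γ x).toNat := by
  rw [SetLike.mem_coe, ← one_le_idealOrder_iff, idealOrder_pointCureMember_excPoint hρ hreg hx2 hxΓ]
  obtain ⟨m, hm⟩ := ENat.ne_top_iff_exists.mp (idealOrder_ne_top hΓ0 x)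
  rw [← hm, ENat.toNat_coe, ← Nat.cast_one, ← ENat.coe_sub, Nat.cast_one, Order.one_le_iff_ne_zero]
  constructor
  · intro h; by_contra hlt; exact h (by exact_mod_cast (show m - 1 = 0 by omega))
  · intro h h0; have : m - 1 = 0 := by exact_mod_cast h0
    omega

/-- A member not through `x` does not pass through `η_E`. [folklore] -/
theorem not_mem_support_pointCureMember_excPoint {Γ : D.IdealSheafData} (hxΓ : x ∉ (Γ.support : Set D)) :
    excPoint hρ hreg hx2 ∉ ((pointCureMember x ρ (vanishingIdeal ⟨{x}, hxc⟩) Γ).support : Set D') := by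
  rw [pointCureMember_of_not_mem hxΓ, Boundary.coe_support_comap, Set.mem_preimage, base_excPoint hρ hreg hx2]
  exact hxΓ

/-- The new member passes through `η_E`. [folklore] -/
theorem excPoint_mem_support_comap_pointIdeal : excPoint hρ hreg hx2 ∈ (((vanishingIdeal ⟨{x}, hxc⟩).comap ρ).support : Set D') :=
  mem_support_comap_centre_of_eq (coe_support_pointIdeal hxc) (base_excPoint hρ hreg hx2)

include hreg hx2 in
open scoped Classical in
/-- **THE MULTIPLICITY LIST OF THE EXCEPTIONAL DIVISOR IS `[1, 1]`** when exactly one member `Γ₀` of the list passes through `x`, with `ord_x Γ₀ = 2` (a counted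
same-member crossing): `Γ₀`'s cure has order `1` along `E`, the new member order `1`; `μ_E = 2·2 − 1 − 2 = 1`. [folklore] -/
theorem Boundary.compMults_pointCure_excPoint [IsIntegral D] [IsLocallyNoetherian D] [IsLocallyNoetherian D'] [IsIntegral D'] {Γs : Boundary D} {Γ₀ : D.IdealSheafData} (hΓ00 : Γ₀ ≠ ⊥)
    (hone : (Γs.filter fun Γ => x ∈ (Γ.support : Set D)) = [Γ₀]) (hord : (idealOrder Γ₀ x).toNat = 2) :
    (Γs.pointCure x ρ (vanishingIdeal ⟨{x}, hxc⟩)).compMults (excPoint hρ hreg hx2) = [1, 1] := by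
  have hxΓ₀ : x ∈ (Γ₀.support : Set D) := by
    have : Γ₀ ∈ Γs.filter fun Γ => x ∈ (Γ.support : Set D) := by rw [hone]; exact List.mem_singleton_self _
    exact of_decide_eq_true (List.mem_filter.mp this).2
  unfold Boundary.compMults membersThrough Boundary.pointCure
  rw [List.filter_append, List.filter_map, List.filter_singleton, decide_eq_true (excPoint_mem_support_comap_pointIdeal hρ hreg hx2 (hxc := hxc)), cond_true,
    List.map_append, List.map_singleton, List.map_map, idealOrder_comap_pointIdeal_excPoint hρ hreg hx2, ENat.toNat_one]
  -- the old members through `η_E` are exactly `Γ₀`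
  have hfilt : (Γs.filter ((fun I => decide (excPoint hρ hreg hx2 ∈ (I.support : Set D'))) ∘ pointCureMember x ρ (vanishingIdeal ⟨{x}, hxc⟩))) =
      Γs.filter fun Γ => x ∈ (Γ.support : Set D) := by
    refine List.filter_congr fun Γ hΓ => ?_
    simp only [Function.comp_apply, decide_eq_decide]
    by_cases h : x ∈ (Γ.support : Set D)
    · have hΓ0 : Γ ≠ ⊥ := by
        have : Γ ∈ Γs.filter fun Γ => x ∈ (Γ.support : Set D) := List.mem_filter.mpr ⟨hΓ, decide_eq_true h⟩
        rw [hone, List.mem_singleton] at this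
        rw [this]; exact hΓ00
      rw [mem_support_pointCureMember_excPoint_iff hρ hreg hx2 hΓ0 h]
      have : Γ = Γ₀ := by
        have : Γ ∈ Γs.filter fun Γ => x ∈ (Γ.support : Set D) := List.mem_filter.mpr ⟨hΓ, decide_eq_true h⟩
        rw [hone, List.mem_singleton] at this
        exact this
      subst this
      simp [h, hord]
    · simp [h, not_mem_support_pointCureMember_excPoint hρ hreg hx2 h]
  rw [hfilt, hone, List.map_singleton]
  simp only [Function.comp_apply, List.cons_append, List.nil_append, List.cons.injEq, and_true]
  have h2 := idealOrder_pointCureMember_excPoint hρ hreg hx2 hxΓ₀ (Γ := Γ₀)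
  obtain ⟨m, hm⟩ := ENat.ne_top_iff_exists.mp (idealOrder_ne_top hΓ00 x)
  rw [← hm, ENat.toNat_coe] at hord
  rw [h2, ← hm, hord]
  rfl

include hreg hx2 in
/-- `η_E` is not the generic point of `D′` (there are points off `E`: over the generic point of `D`). [folklore] -/
theorem coheight_excPoint_ne_zero [IsIntegral D] [IsIntegral D'] : Order.coheight (excPoint hρ hreg hx2) ≠ 0 := by
  intro h0
  have hgen : excPoint hρ hreg hx2 = genericPoint D' := eq_genericPoint_of_coheight_eq_zero h0
  have hgx : genericPoint D ≠ x := by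
    intro e
    have h0' : Order.coheight (genericPoint D) = 0 := by
      rw [Order.coheight_eq_zero]
      intro y hy
      exact Scheme.le_iff_specializes.mpr (genericPoint_specializes y)
    rw [e, hx2] at h0'
    exact two_ne_zero h0'
  obtain ⟨y', hy'⟩ := exists_base_eq_of_ne hρ (coe_support_pointIdeal hxc) hgx
  have : ρ.base y' = x := (specializes_excPoint_iff hρ hreg hx2).mp (hgen ▸ genericPoint_specializes y')
  exact hgx (hy'.symm.trans this)

include hreg hx2 in
/-- **`η_E` HAS CODIMENSION ONE** (`𝔪_{η_E} = (t)` is principal: Krull's Hauptidealsatz gives `dim 𝒪_{η_E} ≤ 1`; and `η_E` is not generic). [cite: StacksProject, Tag 0804] -/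
theorem coheight_excPoint [IsIntegral D] [IsLocallyNoetherian D'] [IsIntegral D'] : Order.coheight (excPoint hρ hreg hx2) = 1 := by
  haveI : IsRegularLocalRing (D.presheaf.stalk (ρ.base (excPoint hρ hreg hx2))) := hreg _
  have hy : stalkIdeal (vanishingIdeal ⟨{x}, hxc⟩) (ρ.base (excPoint hρ hreg hx2)) = maximalIdeal _ := by
    rw [base_excPoint hρ hreg hx2]; exact stalkIdeal_pointIdeal_self hxc
  obtain ⟨t, -, hmax, -, -, -⟩ := hρ.exists_uniformizer_of_mem_maxPoints (excPoint_mem_maxPoints hρ hreg hx2) hy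
  haveI : (maximalIdeal (D'.presheaf.stalk (excPoint hρ hreg hx2))).IsPrincipal := ⟨⟨t, hmax⟩⟩
  have hle : (maximalIdeal (D'.presheaf.stalk (excPoint hρ hreg hx2))).height ≤ 1 :=
    Ideal.height_le_one_of_isPrincipal_of_mem_minimalPrimes (maximalIdeal _) (maximalIdeal _)
      (by rw [Ideal.minimalPrimes_eq_subsingleton_self]; exact Set.mem_singleton _)
  have hdim : ringKrullDim (D'.presheaf.stalk (excPoint hρ hreg hx2)) ≤ 1 := by
    rw [← IsLocalRing.maximalIdeal_height_eq_ringKrullDim]; exact_mod_cast hle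
  rw [ringKrullDim_stalk_eq_coheight] at hdim
  have hle' : Order.coheight (excPoint hρ hreg hx2) ≤ 1 := by exact_mod_cast hdim
  exact le_antisymm hle' (Order.one_le_iff_ne_zero.mpr (coheight_excPoint_ne_zero hρ hreg hx2))

include hreg hx2 in
/-- **`η_E` is a codimension-one point of the new configuration.** [folklore] -/
theorem excPoint_mem_codimOnePoints_pointCure [IsIntegral D] [IsLocallyNoetherian D'] [IsIntegral D'] (Γs : Boundary D) :
    excPoint hρ hreg hx2 ∈ (Γs.pointCure x ρ (vanishingIdeal ⟨{x}, hxc⟩)).codimOnePoints :=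
  ⟨Boundary.mem_divisorSet_pointCure_of_eq (coe_support_pointIdeal hxc) Γs (base_excPoint hρ hreg hx2), coheight_excPoint hρ hreg hx2⟩

end Orders

end Summit.ResolutionOfSingularities.ResolutionOfSingularities.Theorems.SigmaMaxModificationsCorridor3.Sigma

end
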